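import Summits.NavierStokesRegularity.NavierStokesRegularity.Theorems.ForcedAmplifierBlowupAlternativeCore
import Literature.Analysis.FluidPDE.ClassicalSolutionGalilean
import Literature.Analysis.FluidPDE.ClassicalSolutionTorusProofs
import Literature.Analysis.FluidPDE.TorusClassicalNSGalileanBoost
import Literature.Analysis.FluidPDE.TorusPressureReconstruction
import Literature.Analysis.FunctionSpaces.TorusInverseLaplacianCalculus
import Literature.Analysis.FluidPDE.SpaceTimeParametricIntegral
import Literature.Analysis.Calculus.SeeleyExtension
import Literature.Analysis.FunctionSpaces.TorusTimePeriodization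
import HarnessLib

/-!
# Route `ForcedAmplifier`, aside `BlowupAlternative` (item stmt-NavierStokesRegularity-28106) — tools II:
# calculus for the force normalisation

* `exists_smooth_extension` — a torus space–time field smooth on `[0,∞) × 𝕋³` agrees on `[0, L] × 𝕋³` with
  one smooth on `ℝ × 𝕋³` (Seeley's reflection series `Seeley.contDiffOn_extend` + a `Real.smoothTransition`
  time cutoff, `Torus.IsSmoothSpaceTimeOn.cutoff`).
* `prim`, `isSmoothSpaceTimeOn_timePrimitive`, `timeDerivWithin_timePrimitive`, `isDivFree_timePrimitive`,
  `hasZeroMean_timePrimitive` — the time primitive `∫₀ᵗ G(s, ·) ds` of a field jointly smooth on `ℝ × 𝕋³`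
  is jointly smooth (`contDiffOn_parametric_intervalIntegral_prod`), has one-sided time derivative `G`
  within `[0, ∞)`, and inherits divergence-free / mean-zero slices (zero derivative + zero at `t = 0`).
* `classicalNS_force_congr` (torus: forces agreeing on the time set) and `gauge_congr` (on `ℝ³`: trading
  `(P, F)` for `(P', F')` with `-∇P' + F' = -∇P + F`).

Definition-free apart from the data-level `seeleyExtend` and `prim` (real-valued time primitive); no `sorry`.  Sources: [Seeley1964];
[MajdaBertozzi2002] §1.2 (Galilean invariance).  Lens provenance: decomp-ns lens 4, generation 26.
-/

set_option linter.dupNamespace false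

noncomputable section

open Set Function Filter MeasureTheory
open scoped ContDiff Topology Pointwise RealInnerProductSpace

namespace Summit.NavierStokesRegularity.NavierStokesRegularity.Theorems.ForcedAmplifierBlowupAlternativeNormalisation

open Literature.Analysis.FunctionSpaces
open Literature.Analysis.FluidPDE
open Literature.Analysis.Calculus
open Summit.NavierStokesRegularity.NavierStokesRegularity.Theorems.ForcedAmplifierBlowupAlternativeCore

/-! ### Seeley extension in time of a torus space–time field -/

/-- Seeley's reflection series in time, written torus-side: `f` for `t ≥ 0`,
`∑ₖ aₖ φ(2ᵏt/δ) f(−2ᵏt, ·)` for `t < 0`. -/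
def seeleyExtend (δ : ℝ) (f : ℝ → UnitAddTorus (Fin 3) → EuclideanSpace ℝ (Fin 3)) (t : ℝ) (x : UnitAddTorus (Fin 3)) : EuclideanSpace ℝ (Fin 3) :=
  if 0 ≤ t then f t x else ∑' k, Seeley.weight δ k t • f (-(2 : ℝ) ^ k * t) x

/-- The space–time lift of `seeleyExtend` is Seeley's `extend` of the space–time lift. -/
theorem stLift_seeleyExtend (δ : ℝ) (f : ℝ → UnitAddTorus (Fin 3) → EuclideanSpace ℝ (Fin 3)) :
    Torus.stLift (seeleyExtend δ f) = Seeley.extend δ (Torus.stLift f) := by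
  funext p
  obtain ⟨t, y⟩ := p
  by_cases ht : 0 ≤ t
  · rw [Seeley.extend_of_nonneg (show (0 : ℝ) ≤ (t, y).1 from ht), Torus.stLift_apply,
      Torus.stLift_apply, seeleyExtend, if_pos ht]
  · rw [Seeley.extend_of_neg (show (t, y).1 < 0 from lt_of_not_ge ht), Torus.stLift_apply, seeleyExtend,
      if_neg ht]
    refine tsum_congr fun k => ?_
    simp [Seeley.term, Seeley.scale, smul_eq_mul]

/-- **Smooth extension to all times.** A field jointly smooth on `[0,∞) × 𝕋³` agrees on `[0, L]` with a
field jointly smooth on `ℝ × 𝕋³` (Seeley 1964 + a smooth time cutoff). -/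
theorem exists_smooth_extension {f : ℝ → UnitAddTorus (Fin 3) → EuclideanSpace ℝ (Fin 3)} (hf : Torus.IsSmoothSpaceTimeOn (Ici 0) f)
    {L : ℝ} (hL : 0 < L) :
    ∃ g : ℝ → UnitAddTorus (Fin 3) → EuclideanSpace ℝ (Fin 3), Torus.IsSmoothSpaceTimeOn univ g ∧ ∀ t ∈ Icc 0 L, g t = f t := by
  have hδ : 0 < L + 1 := by linarith
  have hF : ContDiffOn ℝ ∞ (Torus.stLift f) (Seeley.slab (L + 1) (univ : Set (EuclideanSpace ℝ (Fin 3)))) :=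
    hf.mono Ico_subset_Ici_self
  have h1 : Torus.IsSmoothSpaceTimeOn (Iio (L + 1)) (seeleyExtend (L + 1) f) := by
    show ContDiffOn ℝ ∞ (Torus.stLift (seeleyExtend (L + 1) f)) (Iio (L + 1) ×ˢ univ)
    rw [stLift_seeleyExtend]
    exact Seeley.contDiffOn_extend hδ isOpen_univ hF
  set χ : ℝ → ℝ := fun t => Real.smoothTransition (2 * (L + 2⁻¹ - t)) with hχ
  have hχs : ContDiff ℝ ∞ χ :=
    Real.smoothTransition.contDiff.comp (contDiff_const.mul (contDiff_const.sub contDiff_id))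
  have hχ1 : ∀ t, t ≤ L → χ t = 1 := fun t ht =>
    Real.smoothTransition.one_of_one_le (by linarith)
  have hχ0 : ∀ t, L + 2⁻¹ ≤ t → χ t = 0 := fun t ht =>
    Real.smoothTransition.zero_of_nonpos (by linarith)
  have hsupp : tsupport χ ⊆ interior (Iio (L + 1)) := by
    rw [interior_Iio]
    have h2 : tsupport χ ⊆ Iic (L + 2⁻¹) :=
      closure_minimal (fun t ht => by
        by_contra hc
        exact ht (hχ0 t (le_of_lt (lt_of_not_ge hc)))) isClosed_Iic
    exact h2.trans fun t ht => lt_of_le_of_lt (mem_Iic.1 ht) (by linarith)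
  refine ⟨fun t x => χ t • seeleyExtend (L + 1) f t x, h1.cutoff hχs hsupp, fun t ht => ?_⟩
  funext x
  show χ t • seeleyExtend (L + 1) f t x = f t x
  rw [hχ1 t ht.2, one_smul, seeleyExtend, if_pos ht.1]

/-! ### Primitives in time -/

/-- The primitive `t ↦ ∫₀ᵗ g` of a vector function of time. -/
def prim (g : ℝ → EuclideanSpace ℝ (Fin 3)) (t : ℝ) : EuclideanSpace ℝ (Fin 3) := ∫ s in (0 : ℝ)..t, g s

/-- `prim g 0 = 0`. -/
theorem prim_zero (g : ℝ → EuclideanSpace ℝ (Fin 3)) : prim g 0 = 0 := intervalIntegral.integral_same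

/-- FTC: the primitive of a continuous `g` has derivative `g`. -/
theorem hasDerivAt_prim {g : ℝ → EuclideanSpace ℝ (Fin 3)} (hg : Continuous g) (t : ℝ) : HasDerivAt (prim g) (g t) t :=
  (hg.integral_hasStrictDerivAt 0 t).hasDerivAt

/-- `deriv (prim g) = g` for continuous `g`. -/
theorem deriv_prim {g : ℝ → EuclideanSpace ℝ (Fin 3)} (hg : Continuous g) : deriv (prim g) = g :=
  funext fun t => (hasDerivAt_prim hg t).deriv

/-- The primitive of a smooth `g` is smooth. -/
theorem contDiff_prim {g : ℝ → EuclideanSpace ℝ (Fin 3)} (hg : ContDiff ℝ ∞ g) : ContDiff ℝ ∞ (prim g) := by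
  rw [contDiff_infty_iff_deriv, deriv_prim hg.continuous]
  exact ⟨fun t => (hasDerivAt_prim hg.continuous t).differentiableAt, hg⟩

/-- Slices of a field jointly smooth on `ℝ × 𝕋³` are continuous in time. -/
theorem continuous_slice_of_univ {G : ℝ → UnitAddTorus (Fin 3) → EuclideanSpace ℝ (Fin 3)} (hG : Torus.IsSmoothSpaceTimeOn univ G) (z : UnitAddTorus (Fin 3)) :
    Continuous fun s => G s z := by
  obtain ⟨y, rfl⟩ := Torus.proj_surjective z
  have hc : Continuous (Torus.stLift G) := by
    have h := hG.continuousOn_stLift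
    rw [univ_prod_univ] at h
    exact continuousOn_univ.1 h
  exact hc.comp (continuous_id.prodMk continuous_const)

/-- **The time primitive of a field jointly smooth on `ℝ × 𝕋³` is jointly smooth** (after the substitution
`s = tσ` it is a parametric integral over the fixed interval `[0,1]`,
`contDiffOn_parametric_intervalIntegral_prod`). -/
theorem isSmoothSpaceTimeOn_timePrimitive {G : ℝ → UnitAddTorus (Fin 3) → EuclideanSpace ℝ (Fin 3)} (hG : Torus.IsSmoothSpaceTimeOn univ G) :
    Torus.IsSmoothSpaceTimeOn univ (fun t z => ∫ s in (0 : ℝ)..t, G s z) := by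
  have hGc : ContDiff ℝ ∞ (Torus.stLift G) := by
    have h : ContDiffOn ℝ ∞ (Torus.stLift G) (univ ×ˢ univ) := hG
    rwa [univ_prod_univ, contDiffOn_univ] at h
  set H : ℝ × (ℝ × EuclideanSpace ℝ (Fin 3)) → EuclideanSpace ℝ (Fin 3) := fun q => q.2.1 • Torus.stLift G (q.2.1 * q.1, q.2.2) with hH
  have hHs : ContDiff ℝ ∞ H :=
    (contDiff_fst.comp contDiff_snd).smul
      (hGc.comp (((contDiff_fst.comp contDiff_snd).mul contDiff_fst).prodMk
        (contDiff_snd.comp contDiff_snd)))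
  have hI := contDiffOn_parametric_intervalIntegral_prod (X := EuclideanSpace ℝ (Fin 3)) (F := EuclideanSpace ℝ (Fin 3)) convex_univ
    (by rw [interior_univ]; exact univ_nonempty) (hHs.contDiffOn (s := univ ×ˢ (univ ×ˢ univ))) 0 1
  show ContDiffOn ℝ ∞ (Torus.stLift fun t z => ∫ s in (0 : ℝ)..t, G s z) (univ ×ˢ univ)
  refine hI.congr fun p _ => ?_
  obtain ⟨t, y⟩ := p
  have e := intervalIntegral.smul_integral_comp_mul_left (f := fun x => Torus.stLift G (x, y))
    (a := (0 : ℝ)) (b := 1) t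
  simp only [mul_zero, mul_one, Torus.stLift_apply] at e
  simp only [Torus.stLift_apply, hH]
  rw [intervalIntegral.integral_smul, e]

/-- FTC for the time primitive of a jointly smooth field, pointwise in space. -/
theorem hasDerivAt_timePrimitive {G : ℝ → UnitAddTorus (Fin 3) → EuclideanSpace ℝ (Fin 3)} (hG : Torus.IsSmoothSpaceTimeOn univ G) (t : ℝ)
    (z : UnitAddTorus (Fin 3)) : HasDerivAt (fun s => ∫ τ in (0 : ℝ)..s, G τ z) (G t z) t :=
  ((continuous_slice_of_univ hG z).integral_hasStrictDerivAt 0 t).hasDerivAt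

/-- `∂ₜ ∫₀ᵗ G = G` (one-sided within any time set of unique differentiability at `t`). -/
theorem timeDerivWithin_timePrimitive {G : ℝ → UnitAddTorus (Fin 3) → EuclideanSpace ℝ (Fin 3)} (hG : Torus.IsSmoothSpaceTimeOn univ G)
    {S : Set ℝ} {t : ℝ} (hS : UniqueDiffWithinAt ℝ S t) :
    Torus.timeDerivWithin S (fun s z => ∫ τ in (0 : ℝ)..s, G τ z) t = G t := by
  funext z
  exact (hasDerivAt_timePrimitive hG t z).hasDerivWithinAt.derivWithin hS

/-- `div ∂ₜU = ∂ₜ (div U)` on a closed slab (template: `Torus.divergence_timeDerivWithin_eq_zero`). -/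
theorem divergence_timeDerivWithin_eq {a b : ℝ} (hab : a < b) {U : ℝ → UnitAddTorus (Fin 3) → EuclideanSpace ℝ (Fin 3)}
    (hU : Torus.IsSmoothSpaceTimeOn (Icc a b) U) {t : ℝ} (ht : t ∈ Icc a b) (x : UnitAddTorus (Fin 3)) :
    Torus.divergence (Torus.timeDerivWithin (Icc a b) U t) x =
      Torus.timeDerivWithin (Icc a b) (fun s => Torus.divergence (U s)) t x := by
  have hUD : UniqueDiffOn ℝ (Icc a b) := uniqueDiffOn_Icc hab
  have hcoord : ∀ i, Torus.IsSmoothSpaceTimeOn (Icc a b) (fun s y => U s y i) := fun i => hU.apply i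
  have h1 : ∀ i, Torus.partialDeriv i (fun y => Torus.timeDerivWithin (Icc a b) U t y i) x =
      Torus.timeDerivWithin (Icc a b) (fun s y => Torus.partialDeriv i (fun z => U s z i) y) t x := by
    intro i
    have hci : (fun y => Torus.timeDerivWithin (Icc a b) U t y i) =
        Torus.timeDerivWithin (Icc a b) (fun s y => U s y i) t := by
      funext y
      exact (Torus.timeDerivWithin_clm_comp hU hUD
        (EuclideanSpace.proj i : EuclideanSpace ℝ (Fin 3) →L[ℝ] ℝ) ht y).symm
    rw [hci, ← Torus.timeDerivWithin_partialDeriv_comm hab (hcoord i) ht i x]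
  rw [Torus.divergence]
  simp_rw [h1]
  rw [← Literature.Analysis.FunctionSpaces.Torus.timeDerivWithin_finset_sum Finset.univ
    (fun i _ => (hcoord i).partialDeriv hUD i) hUD ht x]
  rfl

/-- **The time primitive of divergence-free slices has divergence-free slices** (`s ↦ div U(s, x)`
has zero one-sided derivative `div G(s, x)` and vanishes at `s = 0`). -/
theorem isDivFree_timePrimitive {G : ℝ → UnitAddTorus (Fin 3) → EuclideanSpace ℝ (Fin 3)} (hG : Torus.IsSmoothSpaceTimeOn univ G)
    (hdiv : ∀ t, Torus.IsDivFree (G t)) (t : ℝ) :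
    Torus.IsDivFree (fun z => ∫ τ in (0 : ℝ)..t, G τ z) := by
  intro x
  set U : ℝ → UnitAddTorus (Fin 3) → EuclideanSpace ℝ (Fin 3) := fun s z => ∫ τ in (0 : ℝ)..s, G τ z with hUdef
  set a : ℝ := -(|t| + 1) with ha
  set b : ℝ := |t| + 1 with hb
  have hab : a < b := by
    have := abs_nonneg t
    rw [ha, hb]; linarith
  have h0I : (0 : ℝ) ∈ Icc a b := ⟨by rw [ha]; linarith [abs_nonneg t], by rw [hb]; positivity⟩
  have htI : t ∈ Icc a b := ⟨by rw [ha]; linarith [neg_abs_le t], by rw [hb]; linarith [le_abs_self t]⟩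
  have hUD : UniqueDiffOn ℝ (Icc a b) := uniqueDiffOn_Icc hab
  have hUI : Torus.IsSmoothSpaceTimeOn (Icc a b) U :=
    (isSmoothSpaceTimeOn_timePrimitive hG).mono (subset_univ _)
  have hDI : Torus.IsSmoothSpaceTimeOn (Icc a b) (fun s => Torus.divergence (U s)) := hUI.divergence hUD
  -- the slice `D s := div U(s, x)` has zero derivative within `[a,b]`
  set D : ℝ → ℝ := fun s => Torus.divergence (U s) x with hD
  have hderiv : ∀ s ∈ Icc a b, HasDerivWithinAt D 0 (Icc a b) s := by
    intro s hs
    have h1 := hDI.hasDerivWithinAt_slice hs x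
    have h2 : Torus.timeDerivWithin (Icc a b) (fun s => Torus.divergence (U s)) s x = 0 := by
      rw [← divergence_timeDerivWithin_eq hab hUI hs x, hUdef,
        timeDerivWithin_timePrimitive hG (hUD s hs)]
      exact hdiv s x
    rw [h2] at h1
    exact h1
  have hdiff : DifferentiableOn ℝ D (Icc a b) := fun s hs => (hderiv s hs).differentiableWithinAt
  have hconst := constant_of_derivWithin_zero hdiff fun s hs =>
    (hderiv s (Ico_subset_Icc_self hs)).derivWithin (hUD s (Ico_subset_Icc_self hs))
  have hD0 : D 0 = 0 := by
    have hU0 : U 0 = fun _ => 0 := by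
      funext z
      simp [hUdef]
    simp only [hD, hU0]
    simp [Torus.divergence, Torus.partialDeriv, Torus.lineDeriv]
  show D t = 0
  exact (hconst t htI).trans ((hconst 0 h0I).symm.trans hD0)

/-- **The time primitive of mean-zero slices has mean-zero slices** (`s ↦ ∫ U(s)` has zero one-sided
derivative `∫ G(s) = 0` and vanishes at `s = 0`). -/
theorem hasZeroMean_timePrimitive {G : ℝ → UnitAddTorus (Fin 3) → EuclideanSpace ℝ (Fin 3)} (hG : Torus.IsSmoothSpaceTimeOn univ G)
    (hmean : ∀ t, Torus.HasZeroMean (G t)) (t : ℝ) :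
    Torus.HasZeroMean (fun z => ∫ τ in (0 : ℝ)..t, G τ z) := by
  set U : ℝ → UnitAddTorus (Fin 3) → EuclideanSpace ℝ (Fin 3) := fun s z => ∫ τ in (0 : ℝ)..s, G τ z with hUdef
  set a : ℝ := -(|t| + 1) with ha
  set b : ℝ := |t| + 1 with hb
  have hab : a < b := by
    have := abs_nonneg t
    rw [ha, hb]; linarith
  have h0I : (0 : ℝ) ∈ Icc a b := ⟨by rw [ha]; linarith [abs_nonneg t], by rw [hb]; positivity⟩
  have htI : t ∈ Icc a b := ⟨by rw [ha]; linarith [neg_abs_le t], by rw [hb]; linarith [le_abs_self t]⟩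
  have hUD : UniqueDiffOn ℝ (Icc a b) := uniqueDiffOn_Icc hab
  have hUI : Torus.IsSmoothSpaceTimeOn (Icc a b) U :=
    (isSmoothSpaceTimeOn_timePrimitive hG).mono (subset_univ _)
  set c : ℝ → EuclideanSpace ℝ (Fin 3) := fun s => ∫ z, U s z with hc
  have hderiv : ∀ s ∈ Icc a b, HasDerivWithinAt c 0 (Icc a b) s := by
    intro s hs
    have h1 := hUI.hasDerivWithinAt_integral (convex_Icc a b) hs
    have h2 : ∫ z, Torus.timeDerivWithin (Icc a b) U s z = 0 := by
      rw [hUdef, timeDerivWithin_timePrimitive hG (hUD s hs)]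
      exact hmean s
    rw [h2] at h1
    exact h1
  have hdiff : DifferentiableOn ℝ c (Icc a b) := fun s hs => (hderiv s hs).differentiableWithinAt
  have hconst := constant_of_derivWithin_zero hdiff fun s hs =>
    (hderiv s (Ico_subset_Icc_self hs)).derivWithin (hUD s (Ico_subset_Icc_self hs))
  have hc0 : c 0 = 0 := by
    have hU0 : U 0 = fun _ => 0 := by
      funext z
      simp [hUdef]
    simp only [hc, hU0]
    simp
  show c t = 0
  exact (hconst t htI).trans ((hconst 0 h0I).symm.trans hc0)


/-! ### Two bookkeeping lemmas on classical solutions -/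

/-- Changing the force on the time set does not change the solution class (torus). -/
theorem classicalNS_force_congr {S : Set ℝ} {ν : ℝ} {f g u : ℝ → UnitAddTorus (Fin 3) → EuclideanSpace ℝ (Fin 3)} {p : ℝ → UnitAddTorus (Fin 3) → ℝ}
    (h : Torus.IsClassicalNSSolutionOn S ν f u p) (hfg : ∀ t ∈ S, f t = g t) :
    Torus.IsClassicalNSSolutionOn S ν g u p where
  smooth_velocity := h.smooth_velocity
  smooth_pressure := h.smooth_pressure
  momentum t ht x := by rw [← hfg t ht]; exact h.momentum t ht x
  divFree := h.divFree

/-- **Pressure/force gauge** (on `ℝ³`): trading `(P, F)` for `(P', F')` with `-∇P' + F' = -∇P + F` on the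
time set keeps a classical solution a classical solution. -/
theorem gauge_congr {S : Set ℝ} {ν : ℝ} {F F' U : ℝ → EuclideanSpace ℝ (Fin 3) → EuclideanSpace ℝ (Fin 3)} {P P' : ℝ → EuclideanSpace ℝ (Fin 3) → ℝ}
    (h : IsClassicalNSSolutionOn S ν F U P) (hP' : IsSmoothSpaceTimeOn S P')
    (hFP : ∀ t ∈ S, ∀ y, -gradient (P' t) y + F' t y = -gradient (P t) y + F t y) :
    IsClassicalNSSolutionOn S ν F' U P' where
  smooth_velocity := h.smooth_velocity
  smooth_pressure := hP'
  momentum t ht y := by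
    have e : ∀ a b c : EuclideanSpace ℝ (Fin 3), a - b + c = a + (-b + c) := fun a b c => by abel
    rw [h.momentum t ht y, e, e, hFP t ht y]
  divFree := h.divFree


end Summit.NavierStokesRegularity.NavierStokesRegularity.Theorems.ForcedAmplifierBlowupAlternativeNormalisation

end
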